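import Mathlib.Analysis.SpecialFunctions.SmoothTransition
import Mathlib.Analysis.SpecialFunctions.Sqrt
import Mathlib.MeasureTheory.Integral.IntervalIntegral.FundThmCalculus
import Mathlib.Analysis.Calculus.ContDiff.Deriv
import HarnessLib

/-!
# Route PhotonSphereChannels · crux `ChannelsResolveTameDevelopmentsR` (K2R-T2, stmt-FinalStateConjecture-17430) —
# the SCHWARZSCHILD END, IV-a: the Painlevé–Gullstrand clock correction with far cutoff (a smooth radial
# profile `ψ = F'` equal to `√(2M/r)/(1 + √(2M/r))` on `[r₁/2, R_a]`, vanishing beyond `R_b`, `0 ≤ ψ ≤ f_PG`)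

The `tame` clause of `EndDatum.IsTameEnd` (clock-adapted centred balls with `C⁰`-deviation `≤ 1/2`) FAILS for the
Kerr–Schild clock `t*` near the horizon: every frame `A = [[1, 0], [v, L]]` (forced by `clock ∘ Ψ = x⁰ + clock q`)
has `‖Aᵀ g(x) A − η‖ ≥ 1 − α(x)² = 2M/(r + 2M) > 1/2` at points `r < 2M`, which balls centred at d.o.c. points near
the horizon contain. The cure is a clock of unit lapse near the horizon: Painlevé–Gullstrand time
`τ = t* + F(r)`, `F'(r) = f_PG(r) = s/(1 + s)`, `s = √(2M/r)` (then `g = −dτ² + (dx⃗ + √(2M/r) x̂ dτ)²`: flat slices,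
lapse `1`), cut off to `F = 0` on the far cylinder (where the interface wants `clock = t*`). This file constructs the
profile, definition-free (an existence statement; the witnesses are `Real.smoothTransition` cutoffs and a primitive):

* `Schw.exists_clockProfile` — for `0 < M`, `0 < r₁`, `0 < R_a < R_b` there are smooth `ψ, F : ℝ → ℝ` with `F' = ψ`,
  `F = ψ = 0` on `[R_b, ∞)`, `ψ = f_PG` on `[r₁/2, R_a]`, and `0 ≤ ψ ≤ f_PG` on `(0, ∞)`.

References: P. Painlevé, C. R. Acad. Sci. 173 (1921); A. Gullstrand, Ark. Mat. Astron. Fys. 16 (1922); K. Martel,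
E. Poisson, *Regular coordinate systems for Schwarzschild and other spherical spacetimes*, Am. J. Phys. 69 (2001) 476,
§II [MartelPoisson2001]; M. Visser, arXiv:0706.0622, §2 [arXiv07060622].
-/

noncomputable section
set_option linter.dupNamespace false -- `Summit.FinalStateConjecture.FinalStateConjecture.…` is the tree's layout

open Set Filter Topology MeasureTheory intervalIntegral
open scoped ContDiff Topology

namespace Summit.FinalStateConjecture.FinalStateConjecture.Theorems.TameHull.Schw

/-! ### Smooth cutoffs -/

/-- The rising cutoff `r ↦ smoothTransition ((r − a)/(b − a))`: smooth, `0` on `(-∞, a]`, `1` on `[b, ∞)`, values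
in `[0, 1]` (`a < b`). [folklore] -/
theorem exists_cutoff_rising {a b : ℝ} (hab : a < b) :
    ∃ χ : ℝ → ℝ, ContDiff ℝ ∞ χ ∧ (∀ r, r ≤ a → χ r = 0) ∧ (∀ r, b ≤ r → χ r = 1) ∧ ∀ r, 0 ≤ χ r ∧ χ r ≤ 1 := by
  refine ⟨fun r ↦ Real.smoothTransition ((r - a) / (b - a)), ?_, fun r hr ↦ ?_, fun r hr ↦ ?_, fun r ↦
    ⟨Real.smoothTransition.nonneg _, Real.smoothTransition.le_one _⟩⟩
  · exact Real.smoothTransition.contDiff.comp ((contDiff_id.sub contDiff_const).div_const _)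
  · exact Real.smoothTransition.zero_of_nonpos (div_nonpos_of_nonpos_of_nonneg (by linarith) (by linarith))
  · refine Real.smoothTransition.one_of_one_le ?_
    rw [le_div_iff₀ (by linarith)]
    linarith

/-- The falling cutoff: smooth, `1` on `(-∞, a]`, `0` on `[b, ∞)`, values in `[0, 1]` (`a < b`). [folklore] -/
theorem exists_cutoff_falling {a b : ℝ} (hab : a < b) :
    ∃ χ : ℝ → ℝ, ContDiff ℝ ∞ χ ∧ (∀ r, r ≤ a → χ r = 1) ∧ (∀ r, b ≤ r → χ r = 0) ∧ ∀ r, 0 ≤ χ r ∧ χ r ≤ 1 := by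
  obtain ⟨χ, hχ, h0, h1, hχ01⟩ := exists_cutoff_rising hab
  refine ⟨fun r ↦ 1 - χ r, contDiff_const.sub hχ, fun r hr ↦ by simp only [h0 r hr, sub_zero],
    fun r hr ↦ by simp only [h1 r hr, sub_self], fun r ↦ ⟨?_, ?_⟩⟩
  · linarith [(hχ01 r).2]
  · linarith [(hχ01 r).1]

/-! ### The Painlevé–Gullstrand rate `f_PG(r) = √(2M/r) / (1 + √(2M/r))` -/

/-- `f_PG` is smooth at every `r > 0`. [cite: MartelPoisson2001, §II] -/
theorem contDiffAt_fPG (M : ℝ) {r : ℝ} (hr : 0 < r) :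
    ContDiffAt ℝ ∞ (fun r : ℝ ↦ √(2 * M / r) / (1 + √(2 * M / r))) r := by
  have hs : ContDiffAt ℝ ∞ (fun r : ℝ ↦ √(2 * M / r)) r := by
    by_cases hM : M = 0
    · have : (fun r : ℝ ↦ √(2 * M / r)) = fun _ ↦ 0 := by funext r; simp [hM]
      rw [this]; exact contDiffAt_const
    · refine (Real.contDiffAt_sqrt ?_).comp r ((contDiffAt_const.div contDiffAt_id hr.ne'))
      exact div_ne_zero (by positivity) hr.ne'
  refine hs.div (contDiffAt_const.add hs) ?_
  have := Real.sqrt_nonneg (2 * M / r)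
  positivity

/-- `0 ≤ f_PG < 1`. [cite: MartelPoisson2001, §II] -/
theorem fPG_nonneg_lt_one (M r : ℝ) :
    0 ≤ √(2 * M / r) / (1 + √(2 * M / r)) ∧ √(2 * M / r) / (1 + √(2 * M / r)) < 1 := by
  have hs := Real.sqrt_nonneg (2 * M / r)
  refine ⟨by positivity, ?_⟩
  rw [div_lt_one (by positivity)]
  linarith

/-! ### The profile -/

/-- **The Painlevé–Gullstrand clock correction with far cutoff.** For `0 < M`, `0 < r₁` and `0 < R_a < R_b` there
are SMOOTH `ψ, F : ℝ → ℝ` with `F' = ψ` everywhere, `F = 0` and `ψ = 0` on `[R_b, ∞)` (the clock `t* + F(r)` IS `t*`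
on the far cylinder `{r > R_b}`), `ψ = f_PG = √(2M/r)/(1 + √(2M/r))` on `[r₁/2, R_a]` (unit lapse from inside the horizon
collar out to `R_a`), and `0 ≤ ψ ≤ f_PG` on `(0, ∞)` (the lapse of `t* + F(r)` stays between the Kerr–Schild and the
Painlevé–Gullstrand one). Construction: `ψ = χ₀ · χ · f_PG` with a rising cutoff `χ₀` (`0` below `r₁/4`, `1` above
`r₁/2`: smoothness across the time axis) and a falling cutoff `χ` (`1` below `R_a`, `0` above `R_b`), and
`F(r) = ∫_{R_b}^{r} ψ`. [cite: MartelPoisson2001, §II] -/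
theorem exists_clockProfile : ∀ (M r₁ Ra Rb : ℝ), 0 < M → 0 < r₁ → Ra < Rb → ∃ ψ F : ℝ → ℝ, ContDiff ℝ ∞ ψ ∧ ContDiff ℝ ∞ F ∧ (∀ r, HasDerivAt F (ψ r) r) ∧ (∀ r, Rb ≤ r → F r = 0) ∧ (∀ r, Rb ≤ r → ψ r = 0) ∧ (∀ r, r₁ / 2 ≤ r → r ≤ Ra → ψ r = √(2 * M / r) / (1 + √(2 * M / r))) ∧ ∀ r, 0 < r → 0 ≤ ψ r ∧ ψ r ≤ √(2 * M / r) / (1 + √(2 * M / r)) := by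
  intro M r₁ Ra Rb hM hr₁ hab
  obtain ⟨χ₀, hχ₀, hχ₀0, hχ₀1, hχ₀01⟩ := exists_cutoff_rising (show r₁ / 4 < r₁ / 2 by linarith)
  obtain ⟨χ, hχ, hχ1, hχ0, hχ01⟩ := exists_cutoff_falling hab
  set f : ℝ → ℝ := fun r ↦ √(2 * M / r) / (1 + √(2 * M / r)) with hf
  set ψ : ℝ → ℝ := fun r ↦ χ₀ r * χ r * f r with hψ
  -- smoothness of `ψ`: locally zero below `r₁/4`, a product of smooth factors at `r > 0`
  have hψs : ContDiff ℝ ∞ ψ := by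
    rw [contDiff_iff_contDiffAt]
    intro r
    by_cases hr : r < r₁ / 4
    · have hev : ψ =ᶠ[𝓝 r] fun _ ↦ 0 := by
        filter_upwards [Iio_mem_nhds hr] with t ht
        simp only [hψ, hχ₀0 t (le_of_lt ht), zero_mul]
      exact contDiffAt_const.congr_of_eventuallyEq hev
    · have hr0 : 0 < r := by linarith
      exact (hχ₀.contDiffAt.mul hχ.contDiffAt).mul (contDiffAt_fPG M hr0)
  have hψc : Continuous ψ := hψs.continuous
  -- `F` = the primitive vanishing at `R_b`
  set F : ℝ → ℝ := fun r ↦ ∫ t in Rb..r, ψ t with hF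
  have hFd : ∀ r, HasDerivAt F (ψ r) r := fun r ↦ (hψc.integral_hasStrictDerivAt Rb r).hasDerivAt
  have hFderiv : deriv F = ψ := funext fun r ↦ (hFd r).deriv
  have hFs : ContDiff ℝ ∞ F := contDiff_infty_iff_deriv.mpr ⟨fun r ↦ (hFd r).differentiableAt, by rwa [hFderiv]⟩
  -- `ψ = 0` beyond `R_b`, hence `F = 0` there
  have hψ0 : ∀ r, Rb ≤ r → ψ r = 0 := fun r hr ↦ by simp only [hψ, hχ0 r hr, mul_zero, zero_mul]
  have hF0 : ∀ r, Rb ≤ r → F r = 0 := by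
    intro r hr
    simp only [hF]
    rw [integral_congr (g := fun _ ↦ (0 : ℝ)) fun t ht ↦ ?_, intervalIntegral.integral_zero]
    rw [uIcc_of_le hr] at ht
    exact hψ0 t ht.1
  refine ⟨ψ, F, hψs, hFs, hFd, hF0, hψ0, fun r h1 h2 ↦ ?_, fun r hr ↦ ?_⟩
  · simp only [hψ, hχ₀1 r h1, hχ1 r h2, one_mul, hf]
  · have hf0 := (fPG_nonneg_lt_one M r).1
    have h0 := (hχ₀01 r).1; have h1 := (hχ₀01 r).2; have h2 := (hχ01 r).1; have h3 := (hχ01 r).2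
    refine ⟨by simp only [hψ]; positivity, ?_⟩
    calc ψ r = χ₀ r * χ r * f r := rfl
      _ ≤ 1 * 1 * f r := by gcongr
      _ = _ := by rw [one_mul, one_mul]

end Summit.FinalStateConjecture.FinalStateConjecture.Theorems.TameHull.Schw

end
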